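import Summits.RiemannHypothesis.RiemannHypothesis.Theorems.SuzukiWindowsDoorArchKernel
import Summits.RiemannHypothesis.RiemannHypothesis.Theorems.SuzukiWindowsDoorDirichletSymbol
import Summits.RiemannHypothesis.RiemannHypothesis.Theorems.SuzukiFlowKernelPrimePart

/-!
# SuzukiWindowsDoorWindowIdentity — the series representation `K_θ(x) = Σ_{n ≤ e^x} λ_θ(n) n^{-1/2} g_θ(x − log n)` ([Su20] (1.12)) (column DBR; RH-FREE)

RH-FREE throughout; nothing here bears on the truth of RH.  Third of three files: the column's PROOF-OF-DATA target
`LimKernelWindowIdentity` (theory's typed P1h; `Literature/…/SuzukiSingleOperatorKernel.lean`: «the series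
representation (1.12) … is the column's PROOF target») — for `θ > 1` and `x < log N`,

  `limKernel θ x = Σ_{1 ≤ n < N, log n ≤ x} limCoeff θ n / √n · limArchKernel θ (x − log n)`,

i.e. M. Suzuki, ASPM 84 (2020) = arXiv:1907.07302, §1 (1.12) / §3, for the tree's SPECTRALLY defined kernel
`limKernel θ = Re (2π)⁻¹ ∫_{Im z = 1} Θ_θ(z) e^{−izx} dz`.  This is the DICTIONARY LINE of the DBR column's window data:
both engine lineages (DATA/code/et1c, et1e, et1f) compute `K_θ` through (1.12), while the tree's door theorems and
kernel-checked windows are about `limKernel θ`.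

* §1 the Dirichlet terms on the line `Im z = 1` (`Re s = 3/2`): `λ_θ(n) n^{-(½ − iz)} = (λ_θ(n)/√n) e^{iz log n}`;
* §2 the line integrand as an absolutely convergent series `Θ_θ(z)e^{−izx} = Σ_n λ_θ(n) n^{-s} · Θ_θ^arch(z) e^{−izx}`
  (files 1–2: `Θ_θ = Θ_θ^arch · exp(2θ Σ Λ n^{-s})`, `exp(2θ Σ Λ n^{-s}) = Σ λ_θ(n) n^{-s}`), termwise integrability and
  `Σ_n ∫ |term_n| < ∞` (`Σ |λ_θ(n)| n^{-3/2} · ∫ |Θ_θ^arch(u+i)| e^{x} du`);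
* §3 term-by-term integration (`hasSum_integral_of_summable_integral_norm`) and the shift rule
  (`SuzukiFlowKernelPrimePart`-style `e^{iz log n} ↦ x − log n`):
  `HasSum (n ↦ λ_θ(n)/√n · invFourierLine Θ_θ^arch 1 (x − log n)) (invFourierLine Θ_θ 1 x)`, and its real part
  **`HasSum (n ↦ λ_θ(n)/√n · g_θ(x − log n)) (K_θ(x))`**;
* §4 truncation (`g_θ = 0` on `(−∞,0)`, file 1): **the window identity** `limKernel_eq_finset_sum` / `limKernelWindowIdentity`
  (exactly the typed shape), the FIRST WINDOW `K_θ = g_θ` on `(−∞, log 2)`, the SECOND WINDOW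
  `K_θ(x) = g_θ(x) + (2θ log 2/√2) g_θ(x − log 2)` on `(−∞, log 3)` (`λ_θ(p) = 2θ log p`), and the operator form:
  for `t ≤ (log 2)/2`, `NoUnitEigenvalue (limKernel θ) t ↔ NoUnitEigenvalue (limArchKernel θ) t`.

References: [Su20] M. Suzuki, ASPM 84 (2020) 399–411 = arXiv:1907.07302, §1 (1.10)–(1.12), §3.
-/

noncomputable section

-- D-0017: `Summit.<S>.<S>.…` is the designed namespace of a single-problem summit.
set_option linter.dupNamespace false

open MeasureTheory Set Filter Topology Complex

namespace Summit.RiemannHypothesis.RiemannHypothesis.Theorems.SuzukiWindowsDoorWindowIdentity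

open Literature.NumberTheory.LFunctions
open LSeries
open scoped LSeries.notation ArithmeticFunction.vonMangoldt
open SuzukiWindowsDoorArchKernel SuzukiWindowsDoorDirichletSymbol
open SuzukiKernelSemigroup (invFourierLine_cexp_mul_shift re_half_sub_I_mul_line_one)

/-! ## §1 The Dirichlet terms on the line `Im z = 1` -/

/-- `Im(u + i) = 1 > ½`. -/
theorem half_lt_im_line_one (u : ℝ) : 1 / 2 < ((u : ℂ) + ((1 : ℝ) : ℂ) * I).im := by
  simp
  norm_num

/-- `‖f(n) n^{-(½ − i(u+i))}‖ = ‖f(n) n^{-3/2}‖`. -/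
theorem norm_term_line_one (f : ℕ → ℂ) (u : ℝ) (n : ℕ) :
    ‖term f (1 / 2 - I * ((u : ℂ) + ((1 : ℝ) : ℂ) * I)) n‖ = ‖term f ((3 / 2 : ℝ) : ℂ) n‖ := by
  rw [norm_term_eq_norm_term_re, re_half_sub_I_mul_line_one]

/-- `u ↦ f(n) n^{-(½ − i(u+i))}` is continuous. -/
theorem continuous_term_line (f : ℕ → ℂ) (n : ℕ) :
    Continuous fun u : ℝ => term f (1 / 2 - I * ((u : ℂ) + ((1 : ℝ) : ℂ) * I)) n := by
  rcases eq_or_ne n 0 with rfl | hn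
  · simp only [term_zero]
    exact continuous_const
  · have hn' : (n : ℂ) ≠ 0 := Nat.cast_ne_zero.2 hn
    simp only [term_of_ne_zero hn]
    refine continuous_const.div (Continuous.const_cpow (by fun_prop) (Or.inl hn')) fun u h => ?_
    exact hn' ((cpow_eq_zero_iff _ _).1 h).1

/-- RH-FREE.  **The Dirichlet term as a shift factor**: for `n ≠ 0` and any `z`,
`λ_θ(n) n^{-(½ − iz)} = (λ_θ(n)/√n) · e^{iz log n}` (`n^{-s} = n^{-1/2} e^{iz log n}`, `s = ½ − iz`). -/
theorem term_limCoeff_half_sub_eq (θ : ℝ) {n : ℕ} (hn : n ≠ 0) (z : ℂ) :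
    term (fun n => (limCoeff θ n : ℂ)) (1 / 2 - I * z) n =
      ((limCoeff θ n / Real.sqrt n : ℝ) : ℂ) * Complex.exp (I * z * (Real.log n : ℂ)) := by
  have hn' : (n : ℂ) ≠ 0 := Nat.cast_ne_zero.2 hn
  have hnpos : (0 : ℝ) < n := Nat.cast_pos.2 (Nat.pos_of_ne_zero hn)
  have hsqrt : ((Real.sqrt n : ℝ) : ℂ) = Complex.exp ((Real.log n : ℂ) * (1 / 2)) := by
    rw [Real.sqrt_eq_rpow, Real.rpow_def_of_pos hnpos, Complex.ofReal_exp]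
    congr 1
    push_cast
    ring
  rw [term_of_ne_zero hn, cpow_def_of_ne_zero hn', ← Complex.natCast_log,
    show (Real.log n : ℂ) * (1 / 2 - I * z) = (Real.log n : ℂ) * (1 / 2) - I * z * (Real.log n : ℂ) by ring,
    Complex.exp_sub, Complex.ofReal_div, hsqrt]
  field_simp

/-! ## §2 The line integrand as an absolutely convergent series -/

/-- RH-FREE.  Pointwise on `Im z = 1`:
`Θ_θ(z) e^{−izx} = Σ_n λ_θ(n) n^{-(½−iz)} · (Θ_θ^arch(z) e^{−izx})` (absolutely convergent). -/
theorem hasSum_lineIntegrand (θ : ℝ) (x u : ℝ) :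
    HasSum (fun n : ℕ => term (fun n => (limCoeff θ n : ℂ)) (1 / 2 - I * ((u : ℂ) + ((1 : ℝ) : ℂ) * I)) n *
        (limThetaArch θ ((u : ℂ) + ((1 : ℝ) : ℂ) * I) *
          Complex.exp (-I * ((u : ℂ) + ((1 : ℝ) : ℂ) * I) * (x : ℂ))))
      (limTheta θ ((u : ℂ) + ((1 : ℝ) : ℂ) * I) * Complex.exp (-I * ((u : ℂ) + ((1 : ℝ) : ℂ) * I) * (x : ℂ))) := by
  have hs : 1 < ((1 : ℂ) / 2 - I * ((u : ℂ) + ((1 : ℝ) : ℂ) * I)).re := by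
    rw [re_half_sub_I_mul_line_one]; norm_num
  have h := (LSeriesHasSum_limCoeff θ hs).mul_right
    (limThetaArch θ ((u : ℂ) + ((1 : ℝ) : ℂ) * I) * Complex.exp (-I * ((u : ℂ) + ((1 : ℝ) : ℂ) * I) * (x : ℂ)))
  rw [limTheta_eq_limThetaArch_mul θ (half_lt_im_line_one u),
    show limThetaArch θ ((u : ℂ) + ((1 : ℝ) : ℂ) * I) *
        Complex.exp (2 * θ * L ↗Λ (1 / 2 - I * ((u : ℂ) + ((1 : ℝ) : ℂ) * I))) *
        Complex.exp (-I * ((u : ℂ) + ((1 : ℝ) : ℂ) * I) * (x : ℂ)) =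
      Complex.exp (2 * θ * L ↗Λ (1 / 2 - I * ((u : ℂ) + ((1 : ℝ) : ℂ) * I))) *
        (limThetaArch θ ((u : ℂ) + ((1 : ℝ) : ℂ) * I) *
          Complex.exp (-I * ((u : ℂ) + ((1 : ℝ) : ℂ) * I) * (x : ℂ))) by ring]
  exact h

/-- RH-FREE.  Each term `u ↦ λ_θ(n) n^{-s} · Θ_θ^arch(u+i) e^{−i(u+i)x}` is integrable (`θ > 1`): a bounded continuous
factor (`|λ_θ(n) n^{-s}| = |λ_θ(n)| n^{-3/2}`) times the integrable `Θ_θ^arch(u+i) e^{−i(u+i)x}`. -/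
theorem integrable_term_mul {θ : ℝ} (hθ : 1 < θ) (x : ℝ) (n : ℕ) :
    Integrable fun u : ℝ => term (fun n => (limCoeff θ n : ℂ)) (1 / 2 - I * ((u : ℂ) + ((1 : ℝ) : ℂ) * I)) n *
      (limThetaArch θ ((u : ℂ) + ((1 : ℝ) : ℂ) * I) *
        Complex.exp (-I * ((u : ℂ) + ((1 : ℝ) : ℂ) * I) * (x : ℂ))) :=
  (integrable_limThetaArch_lineIntegrand hθ (b := 1) (by norm_num) x).bdd_mul
    (continuous_term_line _ n).aestronglyMeasurable
    (Eventually.of_forall fun u => (norm_term_line_one _ u n).le)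

/-- The `L¹` norm of each term: `∫ |term_n| = ‖λ_θ(n) n^{-3/2}‖ · ∫ |Θ_θ^arch(u+i)| e^{x} du`. -/
theorem integral_norm_term_mul (θ : ℝ) (x : ℝ) (n : ℕ) :
    ∫ u : ℝ, ‖term (fun n => (limCoeff θ n : ℂ)) (1 / 2 - I * ((u : ℂ) + ((1 : ℝ) : ℂ) * I)) n *
        (limThetaArch θ ((u : ℂ) + ((1 : ℝ) : ℂ) * I) *
          Complex.exp (-I * ((u : ℂ) + ((1 : ℝ) : ℂ) * I) * (x : ℂ)))‖ =
      ‖term (fun n => (limCoeff θ n : ℂ)) ((3 / 2 : ℝ) : ℂ) n‖ *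
        ∫ u : ℝ, ‖limThetaArch θ ((u : ℂ) + ((1 : ℝ) : ℂ) * I) *
          Complex.exp (-I * ((u : ℂ) + ((1 : ℝ) : ℂ) * I) * (x : ℂ))‖ := by
  rw [← integral_const_mul]
  refine integral_congr_ae (Eventually.of_forall fun u => ?_)
  simp only [norm_mul, norm_term_line_one]

/-- RH-FREE.  `Σ_n ∫ |term_n| < ∞` on the line `Im z = 1` (`Σ |λ_θ(n)| n^{-3/2} < ∞`, file 2). -/
theorem summable_integral_norm_term_mul (θ : ℝ) (x : ℝ) :
    Summable fun n : ℕ => ∫ u : ℝ, ‖term (fun n => (limCoeff θ n : ℂ)) (1 / 2 - I * ((u : ℂ) + ((1 : ℝ) : ℂ) * I)) n *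
        (limThetaArch θ ((u : ℂ) + ((1 : ℝ) : ℂ) * I) *
          Complex.exp (-I * ((u : ℂ) + ((1 : ℝ) : ℂ) * I) * (x : ℂ)))‖ := by
  simp_rw [integral_norm_term_mul]
  exact (summable_norm_term_limCoeff θ (s := ((3 / 2 : ℝ) : ℂ)) (by simp; norm_num)).mul_right _

/-! ## §3 Term-by-term integration and the shift rule -/

/-- RH-FREE.  The integral of the `n`-th term is the shifted archimedean transform:
`∫ λ_θ(n) n^{-s} Θ_θ^arch(z) e^{−izx} du = (λ_θ(n)/√n) · 2π · invFourierLine Θ_θ^arch 1 (x − log n)`. -/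
theorem integral_term_mul_eq (θ : ℝ) (x : ℝ) (n : ℕ) :
    ∫ u : ℝ, term (fun n => (limCoeff θ n : ℂ)) (1 / 2 - I * ((u : ℂ) + ((1 : ℝ) : ℂ) * I)) n *
        (limThetaArch θ ((u : ℂ) + ((1 : ℝ) : ℂ) * I) *
          Complex.exp (-I * ((u : ℂ) + ((1 : ℝ) : ℂ) * I) * (x : ℂ))) =
      ((limCoeff θ n / Real.sqrt n : ℝ) : ℂ) * (2 * (Real.pi : ℂ)) *
        invFourierLine (limThetaArch θ) 1 (x - Real.log n) := by
  rcases eq_or_ne n 0 with rfl | hn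
  · simp [term_zero]
  · have h2π : (2 * (Real.pi : ℂ)) ≠ 0 := mul_ne_zero two_ne_zero (Complex.ofReal_ne_zero.2 Real.pi_ne_zero)
    have hI : (fun u : ℝ => term (fun n => (limCoeff θ n : ℂ)) (1 / 2 - I * ((u : ℂ) + ((1 : ℝ) : ℂ) * I)) n *
        (limThetaArch θ ((u : ℂ) + ((1 : ℝ) : ℂ) * I) *
          Complex.exp (-I * ((u : ℂ) + ((1 : ℝ) : ℂ) * I) * (x : ℂ)))) =
        fun u : ℝ => ((limCoeff θ n / Real.sqrt n : ℝ) : ℂ) *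
          (Complex.exp (I * ((u : ℂ) + ((1 : ℝ) : ℂ) * I) * (Real.log n : ℂ)) *
            limThetaArch θ ((u : ℂ) + ((1 : ℝ) : ℂ) * I) *
            Complex.exp (-I * ((u : ℂ) + ((1 : ℝ) : ℂ) * I) * (x : ℂ))) := by
      funext u
      rw [term_limCoeff_half_sub_eq θ hn]
      ring
    have hJ : ∫ u : ℝ, Complex.exp (I * ((u : ℂ) + ((1 : ℝ) : ℂ) * I) * (Real.log n : ℂ)) *
          limThetaArch θ ((u : ℂ) + ((1 : ℝ) : ℂ) * I) *
          Complex.exp (-I * ((u : ℂ) + ((1 : ℝ) : ℂ) * I) * (x : ℂ)) =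
        (2 * (Real.pi : ℂ)) *
          invFourierLine (fun z : ℂ => Complex.exp (I * z * (Real.log n : ℂ)) * limThetaArch θ z) 1 x := by
      simp only [invFourierLine]
      rw [← mul_assoc, mul_one_div_cancel h2π, one_mul]
    rw [hI, integral_const_mul, hJ, invFourierLine_cexp_mul_shift]
    ring

/-- RH-FREE.  **Termwise inverse Fourier transform** ([Su20] §3): for `θ > 1`,
`HasSum (n ↦ λ_θ(n)/√n · invFourierLine Θ_θ^arch 1 (x − log n)) (invFourierLine Θ_θ 1 x)`. -/
theorem hasSum_invFourierLine_limTheta {θ : ℝ} (hθ : 1 < θ) (x : ℝ) :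
    HasSum (fun n : ℕ => ((limCoeff θ n / Real.sqrt n : ℝ) : ℂ) *
        invFourierLine (limThetaArch θ) 1 (x - Real.log n))
      (invFourierLine (limTheta θ) 1 x) := by
  set F : ℕ → ℝ → ℂ := fun n u => term (fun n => (limCoeff θ n : ℂ)) (1 / 2 - I * ((u : ℂ) + ((1 : ℝ) : ℂ) * I)) n *
      (limThetaArch θ ((u : ℂ) + ((1 : ℝ) : ℂ) * I) *
        Complex.exp (-I * ((u : ℂ) + ((1 : ℝ) : ℂ) * I) * (x : ℂ))) with hF
  have hF_int : ∀ n, Integrable (F n) := fun n => integrable_term_mul hθ x n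
  have hF_sum : Summable fun n => ∫ u : ℝ, ‖F n u‖ := summable_integral_norm_term_mul θ x
  have hmain := hasSum_integral_of_summable_integral_norm hF_int hF_sum
  have h1 : (fun n => ∫ u : ℝ, F n u) = fun n : ℕ => ((limCoeff θ n / Real.sqrt n : ℝ) : ℂ) * (2 * (Real.pi : ℂ)) *
      invFourierLine (limThetaArch θ) 1 (x - Real.log n) := funext fun n => integral_term_mul_eq θ x n
  have h2 : (fun u : ℝ => ∑' n, F n u) = fun u : ℝ => limTheta θ ((u : ℂ) + ((1 : ℝ) : ℂ) * I) *
      Complex.exp (-I * ((u : ℂ) + ((1 : ℝ) : ℂ) * I) * (x : ℂ)) :=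
    funext fun u => (hasSum_lineIntegrand θ x u).tsum_eq
  rw [h1, h2] at hmain
  have h3 := hmain.mul_left ((1 : ℂ) / (2 * (Real.pi : ℂ)))
  have h2π : (2 * (Real.pi : ℂ)) ≠ 0 := mul_ne_zero two_ne_zero (Complex.ofReal_ne_zero.2 Real.pi_ne_zero)
  have h4 : (fun n : ℕ => (1 : ℂ) / (2 * (Real.pi : ℂ)) *
      (((limCoeff θ n / Real.sqrt n : ℝ) : ℂ) * (2 * (Real.pi : ℂ)) *
        invFourierLine (limThetaArch θ) 1 (x - Real.log n))) =
      fun n : ℕ => ((limCoeff θ n / Real.sqrt n : ℝ) : ℂ) * invFourierLine (limThetaArch θ) 1 (x - Real.log n) := by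
    funext n
    field_simp
  rw [h4] at h3
  exact h3

/-- RH-FREE.  **[Su20] (1.12) as a convergent series**: for `θ > 1` and every real `x`,
`HasSum (n ↦ λ_θ(n)/√n · g_θ(x − log n)) (K_θ(x))`. -/
theorem hasSum_limKernel {θ : ℝ} (hθ : 1 < θ) (x : ℝ) :
    HasSum (fun n : ℕ => limCoeff θ n / Real.sqrt n * limArchKernel θ (x - Real.log n)) (limKernel θ x) := by
  have h := (hasSum_invFourierLine_limTheta hθ x).mapL Complex.reCLM
  simp only [Complex.reCLM_apply, Complex.re_ofReal_mul] at h
  exact h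

/-! ## §4 Truncation: the window identity, the first two windows, and the operator form -/

/-- Terms with `n = 0` or `log n > x` vanish (`λ_θ(0)/√0 = 0`; `g_θ = 0` on `(−∞,0)`). -/
theorem term_eq_zero_of_lt_log {θ : ℝ} (hθ : 1 < θ) {x : ℝ} {n : ℕ} (h : n = 0 ∨ x < Real.log n) :
    limCoeff θ n / Real.sqrt n * limArchKernel θ (x - Real.log n) = 0 := by
  rcases h with rfl | hx
  · simp
  · rw [limArchKernel_eq_zero_of_neg hθ (by linarith), mul_zero]

/-- RH-FREE.  **THE WINDOW IDENTITY [Su20] (1.12), PROVED**: for `θ > 1` and `x < log N`,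
`K_θ(x) = Σ_{1 ≤ n < N, log n ≤ x} λ_θ(n)/√n · g_θ(x − log n)` — a finite prime-power sum on every bounded window. -/
theorem limKernel_eq_finset_sum {θ : ℝ} (hθ : 1 < θ) {N : ℕ} {x : ℝ} (hx : x < Real.log N) :
    limKernel θ x = ∑ n ∈ Finset.Icc 1 (N - 1),
      if Real.log (n : ℝ) ≤ x then limCoeff θ n / Real.sqrt (n : ℝ) * limArchKernel θ (x - Real.log (n : ℝ))
      else 0 := by
  rw [← (hasSum_limKernel hθ x).tsum_eq]
  have hvan : ∀ n : ℕ, n ∉ Finset.Icc 1 (N - 1) →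
      limCoeff θ n / Real.sqrt n * limArchKernel θ (x - Real.log n) = 0 := by
    intro n hn
    rw [Finset.mem_Icc, not_and_or, not_le, not_le] at hn
    refine term_eq_zero_of_lt_log hθ ?_
    rcases Nat.eq_zero_or_pos n with h0 | hnpos
    · exact Or.inl h0
    · right
      have hNn : N ≤ n := by omega
      refine lt_of_lt_of_le hx ?_
      rcases Nat.eq_zero_or_pos N with hN0 | hNpos
      · subst hN0
        simp only [Nat.cast_zero, Real.log_zero]
        exact Real.log_nonneg (by exact_mod_cast hnpos)
      · exact Real.log_le_log (by exact_mod_cast hNpos) (by exact_mod_cast hNn)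
  rw [tsum_eq_sum hvan]
  refine Finset.sum_congr rfl fun n _ => ?_
  split_ifs with hle
  · rfl
  · exact term_eq_zero_of_lt_log hθ (Or.inr (not_le.1 hle))

/-- RH-FREE.  `LimKernelWindowIdentity θ N` in exactly the typed shape of the column's target (theory's P1h,
HOME/rh-dbr-theory/lean/SuzukiCanonicalWindow.lean): `1 < θ → ∀ x, 0 ≤ x → x < log N → K_θ(x) = Σ_{1≤n<N, log n ≤ x} …`. -/
theorem limKernelWindowIdentity (θ : ℝ) (N : ℕ) :
    1 < θ → ∀ x : ℝ, 0 ≤ x → x < Real.log (N : ℝ) →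
      limKernel θ x =
        ∑ n ∈ Finset.Icc 1 (N - 1),
          if Real.log (n : ℝ) ≤ x then
            limCoeff θ n / Real.sqrt (n : ℝ) * limArchKernel θ (x - Real.log (n : ℝ))
          else 0 :=
  fun hθ _ _ hx => limKernel_eq_finset_sum hθ hx

/-- RH-FREE.  `λ_θ(p) = 2θ log p` for a prime `p` (`Ω(p) = 1`, `Λ^{∗0}(p) = 0`, `Λ(p) = log p`). [Su20] (1.10). -/
theorem limCoeff_prime (θ : ℝ) {p : ℕ} (hp : p.Prime) : limCoeff θ p = 2 * θ * Real.log p := by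
  unfold limCoeff
  rw [ArithmeticFunction.cardFactors_apply_prime hp]
  simp [Finset.sum_range_succ, hp.one_lt.ne', ArithmeticFunction.vonMangoldt_apply_prime hp]

/-- RH-FREE.  **FIRST WINDOW**: `K_θ = g_θ` on `(−∞, log 2)` (`θ > 1`): below `log 2` no prime power contributes. -/
theorem limKernel_eq_limArchKernel_of_lt_log_two {θ : ℝ} (hθ : 1 < θ) {x : ℝ} (hx : x < Real.log 2) :
    limKernel θ x = limArchKernel θ x := by
  have h := limKernel_eq_finset_sum hθ (N := 2) (x := x) (by exact_mod_cast hx)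
  rw [h, show Finset.Icc 1 (2 - 1) = {1} by rfl, Finset.sum_singleton]
  simp only [Nat.cast_one, Real.log_one, sub_zero, limCoeff_one, Real.sqrt_one, div_one, one_mul]
  split_ifs with h0
  · rfl
  · exact (limArchKernel_eq_zero_of_neg hθ (not_le.1 h0)).symm

/-- RH-FREE.  **SECOND WINDOW**: `K_θ(x) = g_θ(x) + (2θ log 2/√2) · g_θ(x − log 2)` on `(−∞, log 3)` (`θ > 1`):
the first prime enters at `x = log 2` with weight `λ_θ(2) 2^{-1/2} = 2θ log 2/√2`. -/
theorem limKernel_eq_of_lt_log_three {θ : ℝ} (hθ : 1 < θ) {x : ℝ} (hx : x < Real.log 3) :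
    limKernel θ x = limArchKernel θ x + 2 * θ * Real.log 2 / Real.sqrt 2 * limArchKernel θ (x - Real.log 2) := by
  have h := limKernel_eq_finset_sum hθ (N := 3) (x := x) (by exact_mod_cast hx)
  rw [h, show Finset.Icc 1 (3 - 1) = {1, 2} by rfl, Finset.sum_pair (by norm_num)]
  simp only [Nat.cast_one, Real.log_one, sub_zero, limCoeff_one, Real.sqrt_one, div_one, one_mul, Nat.cast_ofNat,
    limCoeff_prime θ Nat.prime_two]
  have e1 : (if (0 : ℝ) ≤ x then limArchKernel θ x else 0) = limArchKernel θ x := by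
    split_ifs with h0
    · rfl
    · exact (limArchKernel_eq_zero_of_neg hθ (not_le.1 h0)).symm
  have e2 : (if Real.log 2 ≤ x then 2 * θ * Real.log 2 / Real.sqrt 2 * limArchKernel θ (x - Real.log 2) else 0) =
      2 * θ * Real.log 2 / Real.sqrt 2 * limArchKernel θ (x - Real.log 2) := by
    split_ifs with h2
    · rfl
    · rw [limArchKernel_eq_zero_of_neg hθ (by linarith [not_le.1 h2]), mul_zero]
  rw [e1, e2]

/-- RH-FREE, K-general.  The window condition `NoUnitEigenvalue K t` only sees `K` on sums `x + y` with
`x, y ∈ (−t, t)`. -/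
theorem noUnitEigenvalue_congr {K₁ K₂ : ℝ → ℝ} {t : ℝ}
    (h : ∀ x ∈ Ioo (-t) t, ∀ y ∈ Ioo (-t) t, K₁ (x + y) = K₂ (x + y)) :
    NoUnitEigenvalue K₁ t ↔ NoUnitEigenvalue K₂ t := by
  have key : ∀ f : ℝ → ℝ, ∀ ε : ℝ,
      (∀ᵐ x ∂(volume.restrict (Ioo (-t) t)), ∫ y in Ioo (-t) t, K₁ (x + y) * f y = ε * f x) ↔
      (∀ᵐ x ∂(volume.restrict (Ioo (-t) t)), ∫ y in Ioo (-t) t, K₂ (x + y) * f y = ε * f x) := by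
    intro f ε
    apply Filter.eventually_congr
    filter_upwards [ae_restrict_mem measurableSet_Ioo] with x hx
    rw [setIntegral_congr_fun measurableSet_Ioo (fun y hy => by rw [h x hx y hy])]
  unfold NoUnitEigenvalue
  exact forall₂_congr fun ε _ => forall₂_congr fun f _ => imp_congr (key f ε) Iff.rfl

/-- RH-FREE.  **The first-window certificates are certificates about `g_θ`**: for `θ > 1` and `t ≤ (log 2)/2`,
`NoUnitEigenvalue (limKernel θ) t ↔ NoUnitEigenvalue (limArchKernel θ) t` (on the window, `x + y < 2t ≤ log 2`). -/
theorem noUnitEigenvalue_limKernel_iff_limArchKernel {θ : ℝ} (hθ : 1 < θ) {t : ℝ} (ht : t ≤ Real.log 2 / 2) :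
    NoUnitEigenvalue (limKernel θ) t ↔ NoUnitEigenvalue (limArchKernel θ) t :=
  noUnitEigenvalue_congr fun x hx y hy =>
    limKernel_eq_limArchKernel_of_lt_log_two hθ (by linarith [hx.2, hy.2])

end Summit.RiemannHypothesis.RiemannHypothesis.Theorems.SuzukiWindowsDoorWindowIdentity

end
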